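import Literature.NumberTheory.Rogawski1990.ArchStableOrbitalWallStepOrbitMeasure  -- ★ p841391 (R1-e′): `isFiniteMeasureOnCompacts_map_conj_of_proper`; brings ★ (δ8) properness, ★ (V7) (h1)
import Literature.NumberTheory.Automorphic.ArchTorusOrbitalFunctionAtPoint          -- ★ (j2) `archStableOrbitalIntegral_archDiagTorus_eq_inv_mul_sum_integral_conj`
import HarnessLib

/-!
# THE INITIAL STATE of the place-by-place descent: at a REGULAR global torus point, `Φ^st_∞(t(z), a)` is `K⁻¹ ·` the sum over global relabellings `ρ` of the
# orbit-measure states with the REGULAR ORBIT MEASURES at every place ((R1-0) of R1 «(L-use) at all indefinite places»; Rogawski 1990 §8.2, §14.5)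

Topic `NumberTheory/Automorphic`; namespace `Literature.NumberTheory.Automorphic.UnitaryGroup`.  THEOREMS ONLY (no `def`, no instance, no notation, no axiom, no `sorry`).  `N`-general.
Cell `pub/hodgecm-mathlib`, ENGINE T1 (crux H413 = `stmt-HodgeConjecture-24833`); floor-2 road «(J-nc) in-house», brick (R1-0) of R1 `stub_LuseAllPlaces` (LEAD F0P3a-plan (g9) WORDS
T8-53 ∕ T8-57 ∕ T8-61; census `CENSUS-R1-LuseAllPlaces` 8d436054; author F0P3a-p07 (g7), 2026-09-01).

WHAT.  For `m` canonical on the regular classes for the product Haar measure `ν_∞ = e⁻¹_*(⊗_v ν_v)` and `z` regular at every place,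
`Φ^st_∞(t(z), Θ∘coe) = K⁻¹ · Σ_{ρ : W → S_N} ∫ Θ ↑↑(e⁻¹ o) d(⊗_v ν_v.map (y ↦ y·diag(z_v∘ρ_v)·y⁻¹))(o)` — ★ (j2) `archStableOrbitalIntegral_archDiagTorus_eq_inv_mul_sum_integral_conj`,
★ (h1) `integral_comp_conj_archDiagTorus_map_symm_pi`, and Mathlib `Measure.pi_map_pi` (the regular orbit measures are σ-finite: proper orbit maps ★ p840971 §3 + ★ p841391 §1).
This is the input of ★ (R1-e′) `exists_tendsto_deriv_sin_mul_sum_integral_pi_update_splitCurve` at the first indefinite place (`⊗_v ν_v.map conj = (⊗_v …)[w ↦ ν_w.map conj]`):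
`integral_pi_orbitMeasure_eq_integral_pi_update` records that `update` reading.
HONEST LABEL: HC_CM is proved only modulo the 7 printed citations until rung 0 closes; this file is bookkeeping and pays nothing by itself.

## References
* [Rogawski1990] J. D. Rogawski, *Automorphic Representations of Unitary Groups in Three Variables*, Ann. of Math. Stud. 123 (1990), §4.1 (4.1.1) p. 39, §8.2 p. 118–124, §14.5 p. 238.
* [BorelJacquet1979] A. Borel, H. Jacquet, *Automorphic forms and automorphic representations*, PSPM 33.1 (1979), §4.1.
* [Folland1995] G. B. Folland, *A Course in Abstract Harmonic Analysis* (1995), §2.6 (2.52).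
-/

set_option autoImplicit false

noncomputable section

open MeasureTheory Measure Filter Topology NumberField NumberField.InfinitePlace NumberField.mixedEmbedding Equiv Function Set
open Literature.MeasureTheory.Group Literature.NumberTheory.Automorphic Literature.NumberTheory.Rogawski1990
open Literature.LinearAlgebra.Matrix
open scoped Matrix MatrixGroups

namespace Literature.NumberTheory.Automorphic.UnitaryGroup

variable (L : Type) [Field L] [NumberField L] [IsCMField L] (N : ℕ) (α : Fin N → L)
  [∀ v : {w : InfinitePlace L // IsComplex w}, MeasurableSpace (archLocal L N (Matrix.diagonal α) v)] [∀ v : {w : InfinitePlace L // IsComplex w}, BorelSpace (archLocal L N (Matrix.diagonal α) v)]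
  [MeasurableSpace (arch (↥(maximalRealSubfield L)) L (IsCMField.complexConj L) N (Matrix.diagonal α))] [BorelSpace (arch (↥(maximalRealSubfield L)) L (IsCMField.complexConj L) N (Matrix.diagonal α))]

omit [IsCMField L] [MeasurableSpace (arch (↥(maximalRealSubfield L)) L (IsCMField.complexConj L) N (Matrix.diagonal α))] [BorelSpace (arch (↥(maximalRealSubfield L)) L (IsCMField.complexConj L) N (Matrix.diagonal α))]
  [∀ v : {w : InfinitePlace L // IsComplex w}, BorelSpace (archLocal L N (Matrix.diagonal α) v)] in
open scoped Classical in
/-- The product of ORBIT MEASURES is the product family UPDATED at any place by its own value (the reading ★ (R1-e′) consumes at the first step). [cite: BorelJacquet1979, §4.1] -/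
theorem pi_eq_pi_update_self (μ : ∀ v : {w : InfinitePlace L // IsComplex w}, Measure (archLocal L N (Matrix.diagonal α) v)) (w : {w : InfinitePlace L // IsComplex w}) :
    Measure.pi μ = Measure.pi (Function.update μ w (μ w)) := by
  rw [Function.update_eq_self]

open scoped Classical in
/-- **(R1-0) THE INITIAL STATE**: at a regular global torus point, `Φ^st_∞(t(z), Θ∘coe) = K⁻¹ · Σ_ρ ∫ Θ ↑↑(e⁻¹ o) d(⊗_v ν_v.map (y ↦ y·diag(z_v∘ρ_v)·y⁻¹))`
(★ (j2) + ★ (h1) + Mathlib `Measure.pi_map_pi`; σ-finiteness of the regular orbit measures from properness ★). [cite: Rogawski1990, §4.1 (4.1.1) p. 39; §8.2 Prop. 8.2.1 p. 118]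
[cite: BorelJacquet1979, §4.1] [cite: Folland1995, §2.6 (2.52)] -/
theorem archStableOrbitalIntegral_archDiagTorus_eq_inv_mul_sum_integral_pi_map_conj
    (hα : ∀ i, α i ≠ 0) (hherm : ∀ i, (IsCMField.complexConj L (α i) : L) = α i)
    (νw : ∀ v : {w : InfinitePlace L // IsComplex w}, Measure (archLocal L N (Matrix.diagonal α) v)) [∀ v, (νw v).IsHaarMeasure]
    (νinf : Measure (arch (↥(maximalRealSubfield L)) L (IsCMField.complexConj L) N (Matrix.diagonal α))) [νinf.IsHaarMeasure] [νinf.IsMulRightInvariant]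
    (hνinf : νinf = (Measure.pi νw).map (archPiEquivCM N L (Matrix.diagonal α)).symm)
    [∀ g : arch (↥(maximalRealSubfield L)) L (IsCMField.complexConj L) N (Matrix.diagonal α), MeasurableSpace (arch (↥(maximalRealSubfield L)) L (IsCMField.complexConj L) N (Matrix.diagonal α) ⧸ Subgroup.centralizer ({g} : Set (arch (↥(maximalRealSubfield L)) L (IsCMField.complexConj L) N (Matrix.diagonal α))))]
    [∀ g : arch (↥(maximalRealSubfield L)) L (IsCMField.complexConj L) N (Matrix.diagonal α), BorelSpace (arch (↥(maximalRealSubfield L)) L (IsCMField.complexConj L) N (Matrix.diagonal α) ⧸ Subgroup.centralizer ({g} : Set (arch (↥(maximalRealSubfield L)) L (IsCMField.complexConj L) N (Matrix.diagonal α))))]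
    {m : OrbitalMeasureFamily ↥(arch (↥(maximalRealSubfield L)) L (IsCMField.complexConj L) N (Matrix.diagonal α))} (hm : m.IsCanonical (fun γ => IsRegularElt (γ.val : GL (Fin N) (mixedSpace L))) νinf)
    {z : {w : InfinitePlace L // IsComplex w} → Fin N → Circle} (hz : ∀ v, Function.Injective (z v))
    (Θ : Matrix (Fin N) (Fin N) (mixedSpace L) → ℂ) (hΘ : Continuous Θ) :
    archStableOrbitalIntegral L N (Matrix.diagonal α) m
        (fun g : arch (↥(maximalRealSubfield L)) L (IsCMField.complexConj L) N (Matrix.diagonal α) => Θ ((g : GL (Fin N) (mixedSpace L)) : Matrix (Fin N) (Fin N) (mixedSpace L))) (archDiagTorus L N α z) =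
      ((∏ v : {w : InfinitePlace L // IsComplex w},
          (Finset.univ.filter fun i => 0 < (v.1.embedding (α i)).re).card.factorial *
            (N - (Finset.univ.filter fun i => 0 < (v.1.embedding (α i)).re).card).factorial : ℕ) : ℂ)⁻¹ *
        ∑ ρ : {w : InfinitePlace L // IsComplex w} → Perm (Fin N),
          ∫ o, Θ ((((archPiEquivCM N L (Matrix.diagonal α)).symm o : arch (↥(maximalRealSubfield L)) L (IsCMField.complexConj L) N (Matrix.diagonal α)) : GL (Fin N) (mixedSpace L)) : Matrix (Fin N) (Fin N) (mixedSpace L))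
            ∂(Measure.pi fun v : {w : InfinitePlace L // IsComplex w} => (νw v).map fun y : archLocal L N (Matrix.diagonal α) v =>
              y * (⟨circleDiagonal N (z v ∘ ⇑(ρ v)), circleDiagonal_mem_archLocal_diagonal L N α v (z v ∘ ⇑(ρ v))⟩ : archLocal L N (Matrix.diagonal α) v) * y⁻¹) := by
  haveI : ∀ v : {w : InfinitePlace L // IsComplex w}, LocallyCompactSpace (archLocal L N (Matrix.diagonal α) v) := fun v => locallyCompactSpace_archLocal L N (Matrix.diagonal α) v
  haveI : ∀ v : {w : InfinitePlace L // IsComplex w}, SecondCountableTopology (archLocal L N (Matrix.diagonal α) v) := fun v => secondCountableTopology_archLocal L N (Matrix.diagonal α) v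
  have ha : Continuous fun g : arch (↥(maximalRealSubfield L)) L (IsCMField.complexConj L) N (Matrix.diagonal α) => Θ ((g : GL (Fin N) (mixedSpace L)) : Matrix (Fin N) (Fin N) (mixedSpace L)) :=
    hΘ.comp (Units.continuous_val.comp continuous_subtype_val)
  rw [archStableOrbitalIntegral_archDiagTorus_eq_inv_mul_sum_integral_conj L N α hα hherm hm hz _ ha]
  congr 1
  refine Finset.sum_congr rfl fun ρ _ => ?_
  -- (h1): the global conjugation integral over `e⁻¹_*(⊗ ν_v)` is an integral over `Π_v G_v` of the componentwise conjugates
  rw [hνinf, integral_comp_conj_archDiagTorus_map_symm_pi L N α νw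
    (fun g : arch (↥(maximalRealSubfield L)) L (IsCMField.complexConj L) N (Matrix.diagonal α) => Θ ((g : GL (Fin N) (mixedSpace L)) : Matrix (Fin N) (Fin N) (mixedSpace L))) (fun v => z v ∘ ⇑(ρ v))]
  -- the regular orbit measures are finite on compacts (proper orbit maps at regular points), hence σ-finite
  haveI hfin : ∀ v : {w : InfinitePlace L // IsComplex w}, IsFiniteMeasureOnCompacts ((νw v).map fun y : archLocal L N (Matrix.diagonal α) v =>
      y * (⟨circleDiagonal N (z v ∘ ⇑(ρ v)), circleDiagonal_mem_archLocal_diagonal L N α v (z v ∘ ⇑(ρ v))⟩ : archLocal L N (Matrix.diagonal α) v) * y⁻¹) :=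
    fun v => isFiniteMeasureOnCompacts_map_conj_of_proper L N α v (νw v) _ fun C hC =>
      isCompact_setOf_conj_circleDiagonal_mem_of_injective L N α v hα _ ((hz v).comp (ρ v).injective) C hC
  have hmeas : ∀ v : {w : InfinitePlace L // IsComplex w}, AEMeasurable (fun y : archLocal L N (Matrix.diagonal α) v =>
      y * (⟨circleDiagonal N (z v ∘ ⇑(ρ v)), circleDiagonal_mem_archLocal_diagonal L N α v (z v ∘ ⇑(ρ v))⟩ : archLocal L N (Matrix.diagonal α) v) * y⁻¹) (νw v) :=
    fun v => ((continuous_id.mul continuous_const).mul continuous_id.inv).measurable.aemeasurable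
  rw [← Measure.pi_map_pi hmeas]
  have hφ : AEMeasurable (fun (y : ∀ v : {w : InfinitePlace L // IsComplex w}, archLocal L N (Matrix.diagonal α) v) (v : {w : InfinitePlace L // IsComplex w}) =>
      y v * (⟨circleDiagonal N (z v ∘ ⇑(ρ v)), circleDiagonal_mem_archLocal_diagonal L N α v (z v ∘ ⇑(ρ v))⟩ : archLocal L N (Matrix.diagonal α) v) * (y v)⁻¹)
      (Measure.pi νw) :=
    (continuous_pi fun v => by
      have h1 : Continuous fun y : ∀ v : {w : InfinitePlace L // IsComplex w}, archLocal L N (Matrix.diagonal α) v => y v := continuous_apply v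
      exact (h1.mul continuous_const).mul h1.inv).measurable.aemeasurable
  have hF : Continuous fun o : ∀ v : {w : InfinitePlace L // IsComplex w}, archLocal L N (Matrix.diagonal α) v =>
      Θ ((((archPiEquivCM N L (Matrix.diagonal α)).symm o : arch (↥(maximalRealSubfield L)) L (IsCMField.complexConj L) N (Matrix.diagonal α)) : GL (Fin N) (mixedSpace L)) : Matrix (Fin N) (Fin N) (mixedSpace L)) :=
    ha.comp (archPiEquivCM N L (Matrix.diagonal α)).symm.continuous
  rw [integral_map hφ hF.aestronglyMeasurable]

end Literature.NumberTheory.Automorphic.UnitaryGroup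

end
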